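import Literature.MathematicalPhysics.QuantumFieldTheory.Balaban1983to89.B8Prop3GaugeFixedKLevelSrc
import Literature.MathematicalPhysics.QuantumFieldTheory.Balaban1983to89.B8Thm4Concrete
import Literature.MathematicalPhysics.QuantumFieldTheory.Balaban1983to89.B8Thm4UniqueELan

/-!
# `Balaban1983to89.B8Thm4ConcreteLanE` — [Balaban1985RegularSpaces] THEOREM 4 (p. 88) ∕ THEOREM 8 (p. 101) ON THE CONCRETE `ℤᵈ × 𝔸` CARRIERS IN THE
# LEAF's QUANTIFIER SHAPE, SOURCE-INDEXED GAUGE PREDICATE, PROPOSITION 5's UNIQUENESS SOCKET IN THE REPAIRED («E») CURRENCY: this seat's g4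
# `B8Thm4ConcreteLan.thm4Body_concrete_uniform_lan` with its ONE tower-local binder `SP5u` re-typed to `B8LeafModelZdSockP5uE.SockP5uE`'s text
# (datum `u₁` carried by `Ω₀` with the gauge condition `LanF U₀ φ k` and the (1.62)-shape at `5dL·B₈(α₀ + α₁)`; competitors `e^{iλ}`, `e^{iμ}` read at
# EVERY site, `λ = μ = 0` off `Ω₀`, gradient clause on every bond of `SideTouches (Ω j)`), the last step through dag-n05-d's `Lan`-generic
# `B8Thm4UniqueELan.thm4_unique_eq_lanE` (= n05-a's `B8Thm4UniqueE.thm4_unique_eq_landau138E` with (1.38) abstracted to `Lan`)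

statement-level skeleton of published theorems with citation tags; proofs where landed; nothing here is a claim about the Yang–Mills mass gap

T. Bałaban, *Spaces of regular gauge field configurations on a lattice and gauge fixing conditions*, Commun. Math. Phys. **99** (1985) 75–102
`[Balaban1985RegularSpaces]` ("B8"; journal page = PDF page + 74): Thm 4 p. 88, its proof pp. 88–95, Sect. H p. 101 (Thm 8, (1.146)).

## THE PRINTED TEXT (p. 101 [PDF 27], verbatim)

*"… instead of Landau gauge condition (1.27), (1.38), we may consider a more general condition of the form R(U₀)D^{η*}_{U₀}A = f, (1.146) where
f is a function from the space R(U₀) … it is enough to assume that |f|₍₋₂₎ < γ(α₀ + α₁) with a positive, not too big, constant γ, e.g. γ = 1.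
Inspecting the proofs of the theorems and propositions we can see easily that they work in this more general situation almost without any
changes, only some constants change their numerical values. Thus we have the following generalization of Theorem 2. **Theorem 8.** There exist
constants B₁, B₂(β₀), c₁ such that for arbitrary U₀, U′U₀ satisfying (1.33)–(1.35) with α₀ + α₁ ≦ c₁, and for an arbitrary function f from the
space R(U₀) satisfying the bound |f|₍₋₂₎ < γ(α₀ + α₁), there exists exactly one gauge transformation u satisfying (1.29) and such, that the
conditions (1.36), (1.37), (1.39), and (1.146) hold for the configuration U₁ = U′^{u⁻¹}."*

## WHY THIS FILE (cell `pub-ymgap`, HUMAN RULING D-0062; R134 seat `pub-ymgap-dag-n05-c` g6, DAG node N05 = [B8]; count-neutral)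

dag-n05-d g5's FINDING «SP5u-CURRENCY» (bus 2026-08-27T07:29Z): the Proposition-5 UNIQUENESS binder `SP5u` of this seat's g4∕g5 `_lan` chain
(`B8Thm4ConcreteLan.thm4Body_concrete_uniform_lan` → `B8Thm4CoreZd3Lan.thm4Core_zd3_lan` → `B8Thm8SurvivingZd3H.thm8SurvivingAt_zd3H_univ_lan`, copied
into dag-n05-d's ι-generic `B8Thm8SurvivingZd3MapH`) was generalised from n05-a's PRE-E driver `B8Thm4Concrete.thm4Body_concrete_uniform`: its
competitors' `λ`, `μ` are read on the towers `Bʲ(y)`, `y ∈ Λ_j` ONLY, the gradient clause only on bonds with both ends in one tower, and the datum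
`u₁` carries neither «`u₁ = 1` off `Ω₀`» nor the (1.62)-shape of `U′^{u₁⁻¹}`.  dag-n04-b g5 LOCATED that currency as NOT SERVABLE by the contraction of
record (Prop. 5's (1.102) λ-norm reads EVERY bond touching `Ω_j`, cross-tower bonds included; the JOIN needs the datum's (1.62)-shape), and n05-a g7
REPAIRED the consumer: `B8Thm4UniqueE.thm4_unique_eq_landau138E` + `B8Thm4ConcreteE.thm4Body_concrete_guardedE` with the socket
`B8LeafModelZdSockP5uE.SockP5uE` — whose sourced BODY dag-n05-d g5 has landed (`B8SockP5uEAssemblyBSrc.sockP5uE_body_of_join_b_src`, p506142) and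
whose member-level PROVIDER it files (`B8SockSP5uProviderSrc.sp5uE_of_lettersUB_src`, INTENT-5 (ii)).  THIS FILE is the consumer re-knit dag-n05-d asked
this seat for (INTENT-5 (3), «n05-c's carrier lineage»): `thm4Body_concrete_uniform_lan` VERBATIM except

* the binder `SP5u` := `SockP5uE`'s text (`B8LeafModelZdSockP5uE` l.52–75) with `IsLandau138W L k η (Ω 0) (Λs k) U₀ W ↦ LanF U₀ φ k W` at its three
  places, the source premiss `∀ φ, Adm φ U₀ α₀ α₁ →` inserted after the unitarity of `U′` (as in every other sourced socket of the `_lan` chain), and the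
  (1.62)-constant `5dL·B₈·(α₀ + α₁)` (the chain's enlarged Theorem-4 constant, `5dLB₀ + 2γ′B₀ ≤ 5dLB₈`);
* the last step `B8Prop3GaugeFixedKLevelSrc.thm4_unique_eq_lan ↦ B8Thm4UniqueELan.thm4_unique_eq_lanE (Lan := LanF U₀ φ k)`, fed — exactly as in
  `B8Thm4ConcreteE.thm4Body_concrete_guardedE` l.255–257 — with the competitor's support `hu'S`, gauge condition `hLan'` and (1.62)-shape `h162'`
  (the datum of the socket is the COMPETITOR `u′`; the constructed `u` enters through `hk_Lan`, `h162`, `huS`).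

Everything else — the source index `φ : Φ` with `Adm`, the family `LanF U₀ φ m`, the SOURCED in-edge `SH59src` (`+ γ′B₀(α₀ + α₁)` on both (1.59)-lines),
the enlarged constant `B₈`, the windows `thm4_windows`∕`_extra` at `B₈`, the existence half `B8Prop3GaugeFixedKLevelSrc.thm4_exists_all_levels_supp_src`, the
`logCfg` read-back, the CONCLUSION («∃ c₁(d, L, B₈, B₀′, cu, cP) > 0, ∀ Adm LanF, member data, sockets, ∀ α₀ α₁, ∀ U₀ U′, ∀ admitted φ: ∃ unitary u = 1 off Ω₀
with (1.29), `LanF U₀ φ k (U′^{u⁻¹})`, the (1.62)-shape at `5dLB₈(α₀ + α₁)`, and every competitor u′ = 1 off Ω₀ with (1.29), the gauge condition and the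
(1.62)-shape EQUALS u») — is the g4 file's, byte for byte.  The g4 `_lan` file stands (its theorem is true; only its `SP5u` binder has no provider of record).

ORIGINAL g4 RATIONALE (kept).  
Second brick of the N05 knit's printed member `t8S : B8Thm8Surviving.Thm8SurvivingAt 1 …` (after `B8Prop3GaugeFixedKLevelSrc`: the sourced
Prop.-3 reset and the `Lan`-generic existence∕uniqueness cores).  `B8Thm4Concrete.thm4Body_concrete_uniform` (the END of the t4 chain: Theorem 4
in the leaf's quantifier shape «∃ c₁, ∀ member data, ∀ sockets, ∀ α₀ α₁ ≤ c₁, ∀ U₀ U′U₀ …», uniform threshold) is twinned with: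
(a) a SOURCE INDEX `φ : Φ` quantified with every datum and an abstract admissibility `Adm φ U₀ α₀ α₁` (for Theorem 8: `Φ := Site d → 𝔸`,
`Adm f U₀ α₀ α₁ :=` «`f ∈ R(U₀)`» ∧ «`|f|₍₋₂₎ ≤ γ(α₀ + α₁)`»; for Theorem 4: `Φ := Unit`, `Adm := ⊤`) handed to every socket as a premiss;
(b) the gauge predicate a FAMILY `LanF U₀ φ m W` (Theorem 8: `IsLandau146W L m η (Ω 0) (Λs m) U₀ f W` at the top level `m = k` = (1.146);
the reading at the intermediate levels of the induction is the providers' — print does not spell it out); (c) the in-edge b9 socket SOURCED: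
`SH59src` = `SH59` with `+ γ′B₀(α₀ + α₁)` on both (1.59)-lines ([4] Thm 3.3 applied to (1.57) with the source; `γ′ ≥ 0`); (d) the
(1.62)-constant `5dLB₀(α₀ + α₁)` replaced by `5dL·B₈(α₀ + α₁)` with `5dLB₀ + 2γ′B₀ ≤ 5dLB₈`, `B₀ ≤ B₈` — print's «only some constants change»
(`B₁′ = 5dLB₀ ↦ 5dLB₈`, `α₄ = 8B₀′B₁′(α₀ + α₁)` accordingly); the windows are `B8Thm4Windows.thm4_windows` at `B₈`, with the one window
reading the (1.59)-constant (`36dB₀α₂ ≤ ½`, p. 86) weakened back to `B₀`.  CONCLUSION: the same sentence as `thm4Body_concrete_uniform` —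
∃ `c₁(d, L, B₈, B₀′, cu, cP) > 0`, ∀ `Adm`, `LanF`, member data and sockets, ∀ `α₀, α₁`, ∀ `U₀, U′`, ∀ admitted `φ`: ∃ unitary `u` (= 1 off Ω₀) with (1.29),
`LanF U₀ φ k (U′^{u⁻¹})`, the (1.62)-shape at `5dLB₈(α₀ + α₁)` read through `logCfg`, and «exactly one» among restricted competitors.
PROOF: n05-a's, with `B8Prop3GaugeFixedKLevelSrc.thm4_exists_all_levels_supp_src` ∕ `B8Thm4UniqueELan.thm4_unique_eq_lanE` in place of the `_landau138` pair.

## HONEST SCOPE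

An assembly BY NAME; NO estimate proved anew; the sockets (Prop. 5 at `LanF`, sourced b9, Prop. 5's uniqueness at `LanF` in the E currency) are
HYPOTHESES — their sourced providers are dag-n05-d g5's lineage (`sp5_of_sockLettersRD_src` p508383, `sp5uE_of_lettersUB_src` INTENT-5 (ii)), themselves
modulo [4]'s letters; the `zdGF3`∕`zdGF3H` assemblies are the sequels `B8Thm4CoreZd3LanE` ∕ `B8Thm8SurvivingZd3HE`.  `d ≥ 2`; `T_η ↦ ℤᵈ`; `≤` for print's `<`.
Count-neutral; N05 NOT discharged; one finite `T⁴` programme at fixed `ε`, Bałaban as printed — nothing continuum ∕ ℝ⁴ ∕ OS ∕ mass-gap ∕ Clay.  No `sorry`,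
no `axiom`, no definition, no `instance`.  Unit `pub-ymgap-dag-n05-c` (g6), 2026-08-27.

[cite: Balaban1985RegularSpaces, Thm 8 (1.146) p.101, Thm 4 p.88, (1.29) p.81, (1.38) p.82, (1.62) p.87, Prop. 5 (1.108)–(1.109) p.94, pp.94–95;
Balaban1985BackgroundPropagators, Thm 3.3 p.398]
-/

noncomputable section

open NormedSpace

namespace Literature.MathematicalPhysics.QuantumFieldTheory.Balaban1983to89.B8Thm4ConcreteLanE

open Complex (I)
open MatrixLog B7Prop1Explicit B7Prop2Explicit B7Prop1Local B7Eq92Concrete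
open B7Prop2Explicit (C0 c2')
open B7Prop3Flat (c3)
open B8Ineq132 (covDerivFwd InAk)
open B8Eq119TwistedAxial (Restr129 InAx)
open B8Eq184Proof (gaugeExp cfgExp)
open B8Lemma1NonAbelian (mulCfg)
open B8Eq140Level (SideTouches)
open B8Eq146AExpansion (iEta)
open B7Prop4GeneralLevels (logCovIter linCovIter)
open B8Eq155JBound (Jcur wsup)
open B8ScaledSupNorm (bondNorm msup)
open B8Thm2LogB (blockTop)
open B8Ineq130 (tlo thi)
open B8Eq138LandauZd (logCfg)
open B8Prop3GaugeFixedKLevel (eq_mgauge_inv_of_mgauge_eq mem_unitaryUnits_of_mgauge_eq logField_spec)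
open B8Thm4Concrete (mulCfg_eq_mul)
open B8Prop3GaugeFixedKLevelSrc (thm4_exists_all_levels_supp_src)
open B8Thm4UniqueELan (thm4_unique_eq_lanE)
open B8Thm4Windows (thm4_windows thm4_windows_extra)

-- `Site` alone could resolve to the torus sites of `Setup.lean`; re-export the `ℤ^d` sites of `B7Prop1Explicit`.
export B7Prop1Explicit (Site)

variable {d : ℕ}

section Main

variable {𝔸 : Type*} [CStarAlgebra 𝔸] [Nontrivial 𝔸]

/-- **THEOREM 4 ∕ THEOREM 8 ON THE CONCRETE CARRIERS IN THE LEAF's QUANTIFIER SHAPE, SOURCE-INDEXED GAUGE PREDICATE, MEMBER-UNIFORM THRESHOLD,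
PROPOSITION 5's UNIQUENESS SOCKET IN THE REPAIRED («E») CURRENCY** (module docstring).  `B8Thm4ConcreteLan.thm4Body_concrete_uniform_lan` VERBATIM except
the binder `SP5u` (:= `B8LeafModelZdSockP5uE.SockP5uE`'s text with `IsLandau138W … W ↦ LanF U₀ φ k W`, the source premiss, and the (1.62)-constant
`5dL·B₈(α₀ + α₁)`) and the last step (`B8Thm4UniqueELan.thm4_unique_eq_lanE`).  As there, relative to `B8Thm4Concrete.thm4Body_concrete_uniform`:
every datum carries a source index `φ : Φ` admitted by `Adm φ U₀ α₀ α₁` (a premiss of every socket and of the conclusion); the gauge predicate is the family `LanF U₀ φ m`; the b9 socket `SH59src`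
carries `+ γ′B₀(α₀ + α₁)` on both (1.59)-lines; the (1.62)-constant is `5dL·B₈(α₀ + α₁)` with `B₀ ≤ B₈`, `5dLB₀ + 2γ′B₀ ≤ 5dLB₈`, `2 ≤ 5dLB₈`
(p. 89 «B₁ not too small»).  For Theorem 8 read `Φ := Site d → 𝔸`, `LanF U₀ f k := IsLandau146W L k η (Ω 0) (Λs k) U₀ f` (1.146) and
`Adm f U₀ α₀ α₁ :=` «f from R(U₀), |f|₍₋₂₎ ≤ γ(α₀ + α₁)»; for Theorem 4, `Φ := Unit`, `γ′ := 0`, `B₈ := B₀`.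
[cite: Balaban1985RegularSpaces, Thm 8 (1.146) p.101, Thm 4 p.88, (1.29) p.81, (1.38) p.82, (1.62) p.87, Prop. 5 (1.108)–(1.109) p.94, pp.94–95] -/
theorem thm4Body_concrete_uniform_lanE (hd2 : 2 ≤ d) {L : ℕ} (hL : 2 ≤ L)
    {B₀ B₀' cu cP : ℝ} (hB₀ : 0 < B₀) (hB₀' : 0 < B₀') (hcu : 0 < cu) (hcP : 0 < cP)
    -- the source: an index type `Φ` and the source constants (fixed before the threshold); the admissibility predicate `Adm` read by the
    -- providers and the gauge predicate family `LanF` are quantified AFTER the threshold (they may depend on the member), like the member data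
    {Φ : Type*} {γ' B₈ : ℝ} (hγ' : 0 ≤ γ') (hB₈ : 0 < B₈) (hB₀8 : B₀ ≤ B₈) (hB : 2 ≤ 5 * (d : ℝ) * L * B₈)
    (hγB : 5 * (d : ℝ) * L * B₀ + 2 * (γ' * B₀) ≤ 5 * (d : ℝ) * L * B₈) :
    ∃ c₁ : ℝ, 0 < c₁ ∧ ∀ (Adm : Φ → (Site d → Fin d → 𝔸ˣ) → ℝ → ℝ → Prop)
    (LanF : (Site d → Fin d → 𝔸ˣ) → Φ → ℕ → (Site d → Fin d → 𝔸ˣ) → Prop) (η : ℝ), 0 < η → ∀ (k : ℕ)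
    (Ω : ℕ → Set (Site d)) (hΩ : ∀ j, Ω (j + 1) ⊆ Ω j) (Λs : ℕ → ℕ → Set (Site d)) (Λb : ℕ → ℕ → Set (Site d × Fin d))
    (hbox : ∀ m, m ≤ k → ∀ j, j ≤ m → ∀ c ∈ Λb m j, ∀ x, InBox (loK L j c.1) (bondHiK L j c.1 c.2) x → x ∈ Ω j)
    (hclass : ∀ m, m ≤ k → ∀ j, j ≤ m → ∀ c ∈ Λb m j,
      (c.1 ∈ Λs m j ∧ c.1 + e c.2 ∈ Λs m j) ∨
      (∃ j', j = j' + 1 ∧ (∀ x, (L : ℤ) • c.1 ≤ x → x ≤ (L : ℤ) • c.1 + blockTop L → x ∈ Λs m j') ∧ c.1 + e c.2 ∈ Λs m j) ∨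
      (∃ j', j = j' + 1 ∧ c.1 ∈ Λs m j ∧ (∀ x, (L : ℤ) • (c.1 + e c.2) ≤ x → x ≤ (L : ℤ) • (c.1 + e c.2) + blockTop L → x ∈ Λs m j')))
    (htower : ∀ j, j ≤ k → ∀ y ∈ Λs k j, ∀ x, InBox (tlo L y j) (thi L y j) x → x ∈ Ω j)
    (hpart : ∀ x, x ∈ Ω 0 → ∃ j, j ≤ k ∧ ∃ y ∈ Λs k j, InBox (tlo L y j) (thi L y j) x)
    (SP5base : ∀ α₀ α₁ : ℝ, 0 < α₀ → 0 < α₁ → α₀ + α₁ ≤ cP →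
      ∀ U₀ U' : Site d → Fin d → 𝔸ˣ, (∀ x κ, U₀ x κ ∈ unitaryUnits 𝔸) → (∀ x κ, U' x κ ∈ unitaryUnits 𝔸) →
      ∀ φ : Φ, Adm φ U₀ α₀ α₁ →
      InAk L k η α₀ Ω U₀ → InAk L k η α₀ Ω (mulCfg U' U₀) → (∀ m, m ≤ k → InAx L m (Λs m) U₀ (mulCfg U' U₀)) →
      (∀ j, j ≤ k → ∀ (z : Site d) (μ : Fin d), (∀ x, InBox (loK L j z) (bondHiK L j z μ) x → x ∈ Ω j) →
        ‖(avgIter L (mulCfg U' U₀) j z μ : 𝔸) - (avgIter L U₀ j z μ : 𝔸)‖ ≤ α₁) →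
      (∀ b ∈ {b : Site d × Fin d | SideTouches (Ω 0) b.1 b.2}, ‖((U' b.1 b.2 : 𝔸ˣ) : 𝔸) - 1‖ ≤ α₁) →
      (∃ (v : Site d → 𝔸ˣ) (lam : Site d → 𝔸), (∀ x, v x ∈ unitaryUnits 𝔸) ∧ (∀ x, x ∉ Ω 0 → v x = 1) ∧
        (∀ j, j ≤ 1 → ∀ b ∈ {b : Site d × Fin d | SideTouches (Ω j) b.1 b.2}, (v b.1 : 𝔸) = ((gaugeExp lam b.1 : 𝔸ˣ) : 𝔸) ∧
        (v (b.1 + e b.2) : 𝔸) = ((gaugeExp lam (b.1 + e b.2) : 𝔸ˣ) : 𝔸)) ∧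
        (∀ j, j ≤ 1 → ∀ b ∈ {b : Site d × Fin d | SideTouches (Ω j) b.1 b.2},
        ‖lam b.1‖ ≤ (8 * B₀' * (5 * (d : ℝ) * L * B₈) * (α₀ + α₁)) ∧ ((L : ℝ) ^ j * η) * ‖covDerivFwd η U₀ b.2 lam b.1‖ ≤ (8 * B₀' * (5 * (d : ℝ) * L * B₈) * (α₀ + α₁))) ∧
        LanF U₀ φ 1 (mgauge U₀ v⁻¹ U') ∧ Restr129 L 1 (Λs 1) U₀ ((1 : Site d → 𝔸ˣ) * v)))
    (SP5 : ∀ α₀ α₁ : ℝ, 0 < α₀ → 0 < α₁ → α₀ + α₁ ≤ cP →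
      ∀ U₀ U' : Site d → Fin d → 𝔸ˣ, (∀ x κ, U₀ x κ ∈ unitaryUnits 𝔸) → (∀ x κ, U' x κ ∈ unitaryUnits 𝔸) →
      ∀ φ : Φ, Adm φ U₀ α₀ α₁ →
      InAk L k η α₀ Ω U₀ → InAk L k η α₀ Ω (mulCfg U' U₀) → (∀ m, m ≤ k → InAx L m (Λs m) U₀ (mulCfg U' U₀)) →
      (∀ j, j ≤ k → ∀ (z : Site d) (μ : Fin d), (∀ x, InBox (loK L j z) (bondHiK L j z μ) x → x ∈ Ω j) →
        ‖(avgIter L (mulCfg U' U₀) j z μ : 𝔸) - (avgIter L U₀ j z μ : 𝔸)‖ ≤ α₁) →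
      (∀ b ∈ {b : Site d × Fin d | SideTouches (Ω 0) b.1 b.2}, ‖((U' b.1 b.2 : 𝔸ˣ) : 𝔸) - 1‖ ≤ α₁) →
      (∀ m, 1 ≤ m → m < k → ∀ (u₁ : Site d → 𝔸ˣ) (U₁ : Site d → Fin d → 𝔸ˣ) (A : Site d → Fin d → 𝔸),
        (∀ x, u₁ x ∈ unitaryUnits 𝔸) → (∀ x, x ∉ Ω 0 → u₁ x = 1) → mgauge U₀ u₁ U₁ = U' → Restr129 L m (Λs m) U₀ u₁ →
        LanF U₀ φ m U₁ →
        (∀ j, j ≤ m → ∀ b ∈ {b : Site d × Fin d | SideTouches (Ω j) b.1 b.2},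
        U₁ b.1 b.2 = cfgExp η A b.1 b.2 ∧ IsSelfAdjoint (A b.1 b.2) ∧ ‖A b.1 b.2‖ ≤ (5 * (d : ℝ) * L * B₈ * (α₀ + α₁)) * ((L : ℝ) ^ j * η)⁻¹) →
        ∃ (v : Site d → 𝔸ˣ) (lam : Site d → 𝔸), (∀ x, v x ∈ unitaryUnits 𝔸) ∧ (∀ x, x ∉ Ω 0 → v x = 1) ∧
        (∀ j, j ≤ m + 1 → ∀ b ∈ {b : Site d × Fin d | SideTouches (Ω j) b.1 b.2}, (v b.1 : 𝔸) = ((gaugeExp lam b.1 : 𝔸ˣ) : 𝔸) ∧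
        (v (b.1 + e b.2) : 𝔸) = ((gaugeExp lam (b.1 + e b.2) : 𝔸ˣ) : 𝔸)) ∧
        (∀ j, j ≤ m + 1 → ∀ b ∈ {b : Site d × Fin d | SideTouches (Ω j) b.1 b.2},
        ‖lam b.1‖ ≤ (8 * B₀' * (5 * (d : ℝ) * L * B₈) * (α₀ + α₁)) ∧ ((L : ℝ) ^ j * η) * ‖covDerivFwd η U₀ b.2 lam b.1‖ ≤ (8 * B₀' * (5 * (d : ℝ) * L * B₈) * (α₀ + α₁))) ∧
        LanF U₀ φ (m + 1) (mgauge U₀ v⁻¹ U₁) ∧ Restr129 L (m + 1) (Λs (m + 1)) U₀ (u₁ * v)))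
    (SH59src : ∀ α₀ α₁ : ℝ, 0 < α₀ → 0 < α₁ → α₀ + α₁ ≤ cP →
      ∀ U₀ U' : Site d → Fin d → 𝔸ˣ, (∀ x κ, U₀ x κ ∈ unitaryUnits 𝔸) → (∀ x κ, U' x κ ∈ unitaryUnits 𝔸) →
      ∀ φ : Φ, Adm φ U₀ α₀ α₁ →
      InAk L k η α₀ Ω U₀ → InAk L k η α₀ Ω (mulCfg U' U₀) → (∀ m, m ≤ k → InAx L m (Λs m) U₀ (mulCfg U' U₀)) →
      (∀ j, j ≤ k → ∀ (z : Site d) (μ : Fin d), (∀ x, InBox (loK L j z) (bondHiK L j z μ) x → x ∈ Ω j) →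
        ‖(avgIter L (mulCfg U' U₀) j z μ : 𝔸) - (avgIter L U₀ j z μ : 𝔸)‖ ≤ α₁) →
      (∀ b ∈ {b : Site d × Fin d | SideTouches (Ω 0) b.1 b.2}, ‖((U' b.1 b.2 : 𝔸ˣ) : 𝔸) - 1‖ ≤ α₁) →
      (∀ m, 1 ≤ m → m ≤ k → ∀ (u : Site d → 𝔸ˣ) (W : Site d → Fin d → 𝔸ˣ) (A' : Site d → Fin d → 𝔸),
        (∀ x, u x ∈ unitaryUnits 𝔸) → mgauge U₀ u W = U' → Restr129 L m (Λs m) U₀ u → LanF U₀ φ m W →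
        (∀ y τ, IsSelfAdjoint (A' y τ)) →
        (∀ j, j ≤ m → ∀ y τ, SideTouches (Ω j) y τ →
        W y τ = cfgExp η A' y τ ∧ ‖A' y τ‖ ≤ (2 * (L * (5 * (d : ℝ) * L * B₈ * (α₀ + α₁))) + 8 * (8 * B₀' * (5 * (d : ℝ) * L * B₈) * (α₀ + α₁))) * ((L : ℝ) ^ j * η)⁻¹) →
        (∀ y τ, (∀ j, j ≤ m → ¬ SideTouches (Ω j) y τ) → A' y τ = 0) →
        msup L m η (-(1 : ℝ)) (fun j (b : Site d × Fin d) => SideTouches (Ω j) b.1 b.2) (fun b => A' b.1 b.2)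
        ≤ B₀ * (bondNorm L m η (-(3 : ℝ)) Ω (fun x μ => Jcur η U₀ A' μ x)
        + wsup 1 (fun p : {p : ℕ × (Site d × Fin d) // p.1 ≤ m ∧ p.2 ∈ Λb m p.1} =>
        linCovIter L U₀ (iEta η A') p.1.1 p.1.2.1 p.1.2.2)) + γ' * B₀ * (α₀ + α₁) ∧
        msup L m η (-(2 : ℝ)) (fun j (t : Fin d × Fin d × Site d) => SideTouches (Ω j) t.2.2 t.2.1)
        (fun t => covDerivFwd η U₀ t.1 (fun z => A' z t.2.1) t.2.2)
        ≤ B₀ * (bondNorm L m η (-(3 : ℝ)) Ω (fun x μ => Jcur η U₀ A' μ x)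
        + wsup 1 (fun p : {p : ℕ × (Site d × Fin d) // p.1 ≤ m ∧ p.2 ∈ Λb m p.1} =>
        linCovIter L U₀ (iEta η A') p.1.1 p.1.2.1 p.1.2.2)) + γ' * B₀ * (α₀ + α₁)))
    (SP5u : ∀ α₀ α₁ : ℝ, 0 < α₀ → 0 < α₁ → α₀ + α₁ ≤ cP →
      ∀ U₀ U' : Site d → Fin d → 𝔸ˣ, (∀ x κ, U₀ x κ ∈ unitaryUnits 𝔸) → (∀ x κ, U' x κ ∈ unitaryUnits 𝔸) →
      ∀ φ : Φ, Adm φ U₀ α₀ α₁ →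
      InAk L k η α₀ Ω U₀ → InAk L k η α₀ Ω (mulCfg U' U₀) → (∀ m, m ≤ k → InAx L m (Λs m) U₀ (mulCfg U' U₀)) →
      (∀ j, j ≤ k → ∀ (z : Site d) (μ : Fin d), (∀ x, InBox (loK L j z) (bondHiK L j z μ) x → x ∈ Ω j) →
        ‖(avgIter L (mulCfg U' U₀) j z μ : 𝔸) - (avgIter L U₀ j z μ : 𝔸)‖ ≤ α₁) →
      (∀ b ∈ {b : Site d × Fin d | SideTouches (Ω 0) b.1 b.2}, ‖((U' b.1 b.2 : 𝔸ˣ) : 𝔸) - 1‖ ≤ α₁) →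
      ∀ u₁ : Site d → 𝔸ˣ, (∀ x, u₁ x ∈ unitaryUnits 𝔸) → (∀ x, x ∉ Ω 0 → u₁ x = 1) → Restr129 L k (Λs k) U₀ u₁ →
      LanF U₀ φ k (mgauge U₀ u₁⁻¹ U') →
      (∃ A₁ : Site d → Fin d → 𝔸, ∀ j, j ≤ k → ∀ (x : Site d) (κ : Fin d), SideTouches (Ω j) x κ →
        mgauge U₀ u₁⁻¹ U' x κ = cfgExp η A₁ x κ ∧ ‖A₁ x κ‖ ≤ (5 * (d : ℝ) * L * B₈ * (α₀ + α₁)) * ((L : ℝ) ^ j * η)⁻¹) →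
      ∀ (v w : Site d → 𝔸ˣ) (lam mu : Site d → 𝔸),
      (∀ x, ((gaugeExp lam x : 𝔸ˣ) : 𝔸) = ((v x : 𝔸ˣ) : 𝔸) ∧ IsSelfAdjoint (lam x) ∧ ‖lam x‖ < cu) → (∀ x, x ∉ Ω 0 → lam x = 0) →
      (∀ j, j ≤ k → ∀ b ∈ {b : Site d × Fin d | SideTouches (Ω j) b.1 b.2}, ((L : ℝ) ^ j * η) * ‖covDerivFwd η U₀ b.2 lam b.1‖ < cu) →
      (∀ x, ((gaugeExp mu x : 𝔸ˣ) : 𝔸) = ((w x : 𝔸ˣ) : 𝔸) ∧ IsSelfAdjoint (mu x) ∧ ‖mu x‖ < cu) → (∀ x, x ∉ Ω 0 → mu x = 0) →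
      (∀ j, j ≤ k → ∀ b ∈ {b : Site d × Fin d | SideTouches (Ω j) b.1 b.2}, ((L : ℝ) ^ j * η) * ‖covDerivFwd η U₀ b.2 mu b.1‖ < cu) →
      LanF U₀ φ k (mgauge U₀ v⁻¹ (mgauge U₀ u₁⁻¹ U')) → Restr129 L k (Λs k) U₀ (u₁ * v) →
      LanF U₀ φ k (mgauge U₀ w⁻¹ (mgauge U₀ u₁⁻¹ U')) → Restr129 L k (Λs k) U₀ (u₁ * w) →
      ∀ x, v x = w x),
      ∀ α₀ α₁ : ℝ, 0 < α₀ → 0 < α₁ → α₀ + α₁ ≤ c₁ →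
      ∀ U₀ U' : Site d → Fin d → 𝔸ˣ, (∀ x κ, U₀ x κ ∈ unitaryUnits 𝔸) → (∀ x κ, U' x κ ∈ unitaryUnits 𝔸) →
      ∀ φ : Φ, Adm φ U₀ α₀ α₁ →
      InAk L k η α₀ Ω U₀ → InAk L k η α₀ Ω (mulCfg U' U₀) → (∀ m, m ≤ k → InAx L m (Λs m) U₀ (mulCfg U' U₀)) →
      (∀ j, j ≤ k → ∀ (z : Site d) (μ : Fin d), (∀ x, InBox (loK L j z) (bondHiK L j z μ) x → x ∈ Ω j) →
        ‖(avgIter L (mulCfg U' U₀) j z μ : 𝔸) - (avgIter L U₀ j z μ : 𝔸)‖ ≤ α₁) →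
      (∀ b ∈ {b : Site d × Fin d | SideTouches (Ω 0) b.1 b.2}, ‖((U' b.1 b.2 : 𝔸ˣ) : 𝔸) - 1‖ ≤ α₁) →
      ∃ u : Site d → 𝔸ˣ, (∀ x, u x ∈ unitaryUnits 𝔸) ∧ (∀ x, x ∉ Ω 0 → u x = 1) ∧ Restr129 L k (Λs k) U₀ u ∧
        (1 ≤ k → LanF U₀ φ k (mgauge U₀ u⁻¹ U')) ∧
        (∀ j, j ≤ k → ∀ b ∈ {b : Site d × Fin d | SideTouches (Ω j) b.1 b.2},
          mgauge U₀ u⁻¹ U' b.1 b.2 = cfgExp η (logCfg η (mgauge U₀ u⁻¹ U')) b.1 b.2 ∧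
            IsSelfAdjoint (logCfg η (mgauge U₀ u⁻¹ U') b.1 b.2) ∧
            ‖logCfg η (mgauge U₀ u⁻¹ U') b.1 b.2‖ ≤ (5 * (d : ℝ) * L * B₈ * (α₀ + α₁)) * ((L : ℝ) ^ j * η)⁻¹) ∧
        ∀ u' : Site d → 𝔸ˣ, (∀ x, u' x ∈ unitaryUnits 𝔸) → (∀ x, x ∉ Ω 0 → u' x = 1) → Restr129 L k (Λs k) U₀ u' →
          LanF U₀ φ k (mgauge U₀ u'⁻¹ U') →
          (∃ A' : Site d → Fin d → 𝔸, ∀ j, j ≤ k → ∀ (x : Site d) (κ : Fin d), SideTouches (Ω j) x κ →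
            mgauge U₀ u'⁻¹ U' x κ = cfgExp η A' x κ ∧ ‖A' x κ‖ ≤ (5 * (d : ℝ) * L * B₈ * (α₀ + α₁)) * ((L : ℝ) ^ j * η)⁻¹) →
          (1 ≤ k) → u' = u := by
  have hL1 : 1 ≤ L := le_trans (by norm_num) hL
  have hd1 : 1 ≤ d := le_trans (by norm_num) hd2
  have hd' : (1 : ℝ) ≤ d := by exact_mod_cast hd1
  have hL' : (1 : ℝ) ≤ L := by exact_mod_cast hL1
  obtain ⟨c₁, hc₁, hw⟩ := thm4_windows hd1 hL1 hB₈ hB₀' hB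
  obtain ⟨c₂, hc₂, hw'⟩ := thm4_windows_extra (d := d) hL1
  -- the threshold for Proposition 5's uniqueness radius: `2000·d·c⋆ ≤ cu`
  obtain ⟨c₃, hc₃def⟩ : ∃ c₃ : ℝ, c₃ = cu / (2000 * d * (5 * d * L * B₈)) := ⟨_, rfl⟩
  have hc₃ : 0 < c₃ := by rw [hc₃def]; positivity
  refine ⟨min (min c₁ c₂) (min cP c₃), lt_min (lt_min hc₁ hc₂) (lt_min hcP hc₃), ?_⟩
  intro Adm LanF η hη k Ω hΩ Λs Λb hbox hclass htower hpart SP5base SP5 SH59src SP5u α₀ α₁ hα₀ hα₁ hS U₀ U' hU₀ hU' φ hφ h33 h34 hAx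
    h135 h66
  have hS1 : α₀ + α₁ ≤ c₁ := hS.trans ((min_le_left _ _).trans (min_le_left _ _))
  have hS2 : α₀ + α₁ ≤ c₂ := hS.trans ((min_le_left _ _).trans (min_le_right _ _))
  have hSP : α₀ + α₁ ≤ cP := hS.trans ((min_le_right _ _).trans (min_le_left _ _))
  have hS3 : α₀ + α₁ ≤ c₃ := hS.trans ((min_le_right _ _).trans (min_le_right _ _))
  have hS0 : 0 ≤ α₀ + α₁ := by linarith
  obtain ⟨w1, w2, w3, w4, w5, w6, w7, w8, w9, w10, w11, w12, w13, w14, w15, w16, w17, w18⟩ :=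
    hw α₀ α₁ hα₀ hα₁ hS1 (5 * (d : ℝ) * L * B₈ * (α₀ + α₁)) (8 * B₀' * (5 * (d : ℝ) * L * B₈) * (α₀ + α₁)) rfl rfl
  obtain ⟨w19, w20⟩ := hw' α₀ α₁ hα₀ hα₁ hS2
  have hcs0 : 0 ≤ 5 * (d : ℝ) * L * B₈ * (α₀ + α₁) := by positivity
  have hα₄0 : 0 ≤ 8 * B₀' * (5 * (d : ℝ) * L * B₈) * (α₀ + α₁) := by positivity
  -- EXISTENCE (support form) at the top level `k`
  -- the source terms of the sourced in-edge and the enlarged reset constant `5dL·B₈ ≥ 5dL·B₀ + 2γ′B₀`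
  have hT0 : 0 ≤ γ' * B₀ * (α₀ + α₁) := by positivity
  have hc8 : 5 * (d : ℝ) * L * B₀ * (α₀ + α₁) + (γ' * B₀ * (α₀ + α₁) + γ' * B₀ * (α₀ + α₁)) ≤ 5 * (d : ℝ) * L * B₈ * (α₀ + α₁) := by
    have h := mul_le_mul_of_nonneg_right hγB hS0
    calc 5 * (d : ℝ) * L * B₀ * (α₀ + α₁) + (γ' * B₀ * (α₀ + α₁) + γ' * B₀ * (α₀ + α₁))
        = (5 * (d : ℝ) * L * B₀ + 2 * (γ' * B₀)) * (α₀ + α₁) := by ring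
      _ ≤ 5 * (d : ℝ) * L * B₈ * (α₀ + α₁) := h
  have w11' : 36 * d * B₀ * (2 * (L * (5 * (d : ℝ) * L * B₈ * (α₀ + α₁))) + 8 * (8 * B₀' * (5 * (d : ℝ) * L * B₈) * (α₀ + α₁))) ≤ 1 / 2 := by
    have hα₂0 : 0 ≤ 2 * (L * (5 * (d : ℝ) * L * B₈ * (α₀ + α₁))) + 8 * (8 * B₀' * (5 * (d : ℝ) * L * B₈) * (α₀ + α₁)) := by positivity
    have h : 36 * d * B₀ * (2 * (L * (5 * (d : ℝ) * L * B₈ * (α₀ + α₁))) + 8 * (8 * B₀' * (5 * (d : ℝ) * L * B₈) * (α₀ + α₁))) ≤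
        36 * d * B₈ * (2 * (L * (5 * (d : ℝ) * L * B₈ * (α₀ + α₁))) + 8 * (8 * B₀' * (5 * (d : ℝ) * L * B₈) * (α₀ + α₁))) := by
      have h36 : 36 * (d : ℝ) * B₀ ≤ 36 * (d : ℝ) * B₈ := mul_le_mul_of_nonneg_left hB₀8 (by positivity)
      exact mul_le_mul_of_nonneg_right h36 hα₂0
    exact h.trans w11
  obtain ⟨u, hu, huS, h129, W, hW, hLan, A, hA⟩ := thm4_exists_all_levels_supp_src hd2 hη hL k hU₀ hU' hα₀ hα₁ hα₄0 hB₀.le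
    hT0 hT0 hc8 w1 w2 w3 w4 w5 w6 w7 w8 w9 w10 w11' w12 w19 w13 w14 Ω hΩ Λs Λb hbox hclass h33 h34 hAx h135 h66 (LanF U₀ φ)
    (SP5base α₀ α₁ hα₀ hα₁ hSP U₀ U' hU₀ hU' φ hφ h33 h34 hAx h135 h66) (SP5 α₀ α₁ hα₀ hα₁ hSP U₀ U' hU₀ hU' φ hφ h33 h34 hAx h135 h66)
    (SH59src α₀ α₁ hα₀ hα₁ hSP U₀ U' hU₀ hU' φ hφ h33 h34 hAx h135 h66) k le_rfl
  have hWeq : W = mgauge U₀ u⁻¹ U' := eq_mgauge_inv_of_mgauge_eq hW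
  have hWu : ∀ x κ, W x κ ∈ unitaryUnits 𝔸 := mem_unitaryUnits_of_mgauge_eq hU₀ hU' hu hW
  -- `c⋆ ≤ 1/16` for the logarithm device
  have hc16 : 5 * (d : ℝ) * L * B₈ * (α₀ + α₁) ≤ 1 / 16 := by
    have h₁ : (1 : ℝ) * (5 * (d : ℝ) * L * B₈ * (α₀ + α₁)) ≤ L * (5 * (d : ℝ) * L * B₈ * (α₀ + α₁)) :=
      mul_le_mul_of_nonneg_right hL' hcs0
    linarith
  -- the exponent read back as `logCfg`
  have hleaf : ∀ j, j ≤ k → ∀ b ∈ {b : Site d × Fin d | SideTouches (Ω j) b.1 b.2},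
      mgauge U₀ u⁻¹ U' b.1 b.2 = cfgExp η (logCfg η (mgauge U₀ u⁻¹ U')) b.1 b.2 ∧
        IsSelfAdjoint (logCfg η (mgauge U₀ u⁻¹ U') b.1 b.2) ∧
        ‖logCfg η (mgauge U₀ u⁻¹ U') b.1 b.2‖ ≤ (5 * (d : ℝ) * L * B₈ * (α₀ + α₁)) * ((L : ℝ) ^ j * η)⁻¹ := by
    intro j hj b hb
    obtain ⟨hexp, -, hbd⟩ := hA j hj b hb
    have hbd' : ‖A b.1 b.2‖ ≤ (5 * (d : ℝ) * L * B₈ * (α₀ + α₁)) * η⁻¹ := by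
      refine hbd.trans ?_
      have hLj : (1 : ℝ) ≤ (L : ℝ) ^ j := one_le_pow₀ hL'
      have : ((L : ℝ) ^ j * η)⁻¹ ≤ η⁻¹ := by
        rw [mul_inv]
        calc ((L : ℝ) ^ j)⁻¹ * η⁻¹ ≤ 1 * η⁻¹ := by gcongr; exact inv_le_one_of_one_le₀ hLj
          _ = η⁻¹ := one_mul _
      exact mul_le_mul_of_nonneg_left this hcs0
    obtain ⟨hlogA, hsa, hWexp⟩ := logField_spec hη U₀ hWu hexp hbd' hc16
    rw [← hWeq]
    refine ⟨hWexp, ?_, ?_⟩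
    · simpa [logCfg] using hsa
    · show ‖logCfg η W b.1 b.2‖ ≤ _
      rw [logCfg, hlogA]
      exact hbd
  refine ⟨u, hu, huS, h129, fun hk => hWeq ▸ hLan hk, hleaf, ?_⟩
  -- UNIQUENESS: any other restricted u′ with (1.38) and the (1.62)-shape equals u
  intro u' hu' hu'S h129' hLan' h162' hk1
  have hk_Lan : LanF U₀ φ k (mgauge U₀ u⁻¹ U') := hWeq ▸ hLan hk1
  have h162 : ∃ A₂ : Site d → Fin d → 𝔸, ∀ j, j ≤ k → ∀ (x : Site d) (κ : Fin d), SideTouches (Ω j) x κ →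
      mgauge U₀ u⁻¹ U' x κ = cfgExp η A₂ x κ ∧ ‖A₂ x κ‖ ≤ (5 * (d : ℝ) * L * B₈ * (α₀ + α₁)) * ((L : ℝ) ^ j * η)⁻¹ := by
    refine ⟨A, fun j hj x κ hxκ => ?_⟩
    obtain ⟨hexp, -, hbd⟩ := hA j hj (x, κ) hxκ
    rw [← hWeq]
    exact ⟨hexp, hbd⟩
  -- the windows of the uniqueness clause at `c := c⋆`, `α_P := α₀`, and Prop. 5's radius `cu`
  obtain ⟨cs, hcsdef⟩ : ∃ cs : ℝ, cs = 5 * (d : ℝ) * L * B₈ * (α₀ + α₁) := ⟨_, rfl⟩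
  have hcs0' : 0 ≤ cs := by rw [hcsdef]; positivity
  have h2000 : 2000 * (d : ℝ) * cs ≤ cu := by
    have hden : 0 < 2000 * (d : ℝ) * (5 * d * L * B₈) := by positivity
    have h := (le_div_iff₀ hden).1 (hS3.trans (le_of_eq hc₃def))
    have e : 2000 * (d : ℝ) * cs = (α₀ + α₁) * (2000 * d * (5 * d * L * B₈)) := by rw [hcsdef]; ring
    linarith
  have hcu₂ : 5 * cs < cu := by
    have h₁ : (1 : ℝ) * cs ≤ d * cs := mul_le_mul_of_nonneg_right hd' hcs0'
    have hdcs : 0 ≤ (d : ℝ) * cs := by positivity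
    linarith
  have hcu₁ : 2 * (2 * (40 * d * cs) + 2 * 1116 * (40 * d * cs) ^ 2) < cu := by
    have hx0 : 0 ≤ 40 * d * cs := by positivity
    have hx1 : 40 * d * cs ≤ 1 / 5000 := by rw [hcsdef]; exact w16
    have hsq : (40 * d * cs) ^ 2 ≤ 40 * d * cs * (1 / 5000) := by rw [sq]; exact mul_le_mul_of_nonneg_left hx1 hx0
    have hdcs : 0 ≤ (d : ℝ) * cs := by positivity
    linarith
  rw [hcsdef] at hcu₁ hcu₂
  exact thm4_unique_eq_lanE (Lan := LanF U₀ φ k) hd2 hL hη hU₀ hU' hu' hu hα₀ w5 w6 hcs0 w18 w17 w15 w16 hα₀ w5 w20 hcu₁ hcu₂ h33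
    (by rw [← mulCfg_eq_mul]; exact h34) (by rw [← mulCfg_eq_mul]; exact hAx k le_rfl) htower h129' h129 hLan' hk_Lan h162' h162
    (SP5u α₀ α₁ hα₀ hα₁ hSP U₀ U' hU₀ hU' φ hφ h33 h34 hAx h135 h66 u' hu' hu'S h129' hLan' h162') hpart hu'S huS

end Main

#print axioms thm4Body_concrete_uniform_lanE

end Literature.MathematicalPhysics.QuantumFieldTheory.Balaban1983to89.B8Thm4ConcreteLanE

end
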